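import Mathlib
import HarnessLib
import Literature.MathematicalPhysics.QuantumFieldTheory.Luscher2010.EulerStepProofs

/-!
# The `SU(N)` residual / stout coupling layer is a bijection for every `N` under the engine's contraction certificate `κ < 1`: unique pre-image, geometric convergence of the inverse iteration, two-sided Lipschitz bounds

HONEST FRAMING: exact (Metropolis-corrected) sampling algorithms for lattice gauge theory;
figures of merit are autocorrelation/cost numbers at stated couplings and volumes; no
continuum-physics claim.

Venture `LatticeQCDFlow` (cell pub-lqcd), topic `Exactness`; FANOUT row 10 (`eng-equiv`, engine
`latflow.equiv`, module `equiv/residual.py` — `ResidualCoupling`, `contraction_bound`,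
`NonBijectiveLayer`, the BIJECTIVITY GUARD of its docstring: "`U → e^{Q(U)} U` is a
diffeomorphism of `SU(N)` per link IF the fixed-point map `g(U) = e^{−Q(U)} U'` is a contraction …
`κ < 1` is a SUFFICIENT condition for a unique preimage (Banach) … Inverse by fixed-point
iteration `U^{(k+1)} = exp(−Q(U^{(k)})) U'` (geometric convergence at rate kappa)"; the same
layers in `latflow.flows_jax.layers` / `residual_flow`, releases `equiv-0.1.0 … 0.4.1`).  NEW WORK
of the cell over the tree's `Literature/…/Luscher2010/EulerStepProofs.lean` (the Frobenius
tools: `exp` is `1`-Lipschitz on `𝔰𝔲(n)`, `exp 𝔰𝔲(n) ⊆ SU(n)`, and Lüscher's App. D contraction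
for the PURE Wilson-flow Euler step, one link, unit staple weights) and row 14's
`SU2ResidualLayer.lean` (the `SU(2)` rung in quaternion coordinates); nothing is cited as a fact;
no number; no definition is introduced.  Printed counterparts, NAMED ONLY: M. Lüscher, CMP 293
(2010) 899, §5.2 and App. D; Abbott et al., arXiv:2305.02402 §4.2 (residual layers); Morningstar–
Peardon, PRD 69 (2004) 054501 (stout smearing).

## What is typed (one active link; `n` arbitrary; Frobenius norm `‖·‖_F = frobNorm`)

The engine's residual layer replaces an active link `U ∈ SU(n)` by `e^{Q(U)} U`, where the
exponent `Q(U) ∈ 𝔰𝔲(n)` is built from the loops through the link with FROZEN staples and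
coefficients (constants, a defect profile, or a conditioner reading frozen context).  The only
thing used about `Q` here is the engine's certificate: `Q` maps `SU(n)` into `𝔰𝔲(n)` and is
`κ`-Lipschitz on `SU(n)` in the Frobenius norm with `κ < 1` (`contraction_bound`; the concrete
`κ = Σ_j Σ_k (1 + k)|a_{jk}|` of the polynomial staple weights is the sequel file).

* `residual_value_mem` — `e^{Q(U)} U ∈ SU(n)`; `expNeg_mul_mem` — `e^{−X} U' ∈ SU(n)` for
  `X ∈ 𝔰𝔲(n)`;
* **`frobNorm_fixedPointMap_sub_le`** — the engine's fixed-point map `g(U) = e^{−Q(U)} U'` is a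
  `κ`-contraction of `SU(n)`: `‖g U − g V‖_F ≤ κ ‖U − V‖_F` (`exp` is `1`-Lipschitz on `𝔰𝔲(n)`,
  right multiplication by the unitary `U'` is a Frobenius isometry);
* `frobNorm_luscherMap_sub_le`, **`existsUnique_fixedPoint_luscherMap`** — the same contraction
  transported to the complete linear space `𝔰𝔲(n)` (`X ↦ Q(e^{−X} U')`, Lüscher's (D.6) with a
  general exponent) and its unique Banach fixed point;
* **`existsUnique_residual_preimage`** — THE GUARD'S CLAIM: for every `U' ∈ SU(n)` there is
  EXACTLY ONE `U ∈ SU(n)` with `e^{Q(U)} U = U'`; **`residualLayer_bijective`** — the one-link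
  layer is a bijection of `SU(n)`;
* **`frobNorm_inverseIteration_le`** — the engine's inverse pass: from ANY start `U₀ ∈ SU(n)`
  the iterates `U_{k+1} = e^{−Q(U_k)} U'` stay in `SU(n)` and satisfy
  `‖U_k − U⋆‖_F ≤ κ^k ‖U₀ − U⋆‖_F`, `U⋆` the pre-image ("geometric convergence at rate kappa");
* **`frobNorm_sub_le_of_residual`** / `frobNorm_residual_sub_le` — two-sided Lipschitz bounds
  `(1 − κ)‖U − V‖_F ≤ ‖e^{Q U}U − e^{Q V}V‖_F ≤ (1 + κ)‖U − V‖_F`: the layer and its inverse are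
  Lipschitz (so the layer is a bi-Lipschitz homeomorphism of `SU(n)`, and an everywhere-defined
  measurable transport map with measurable inverse).

NOT here: the Jacobian `|det(1 + Φ_Q ∘ DQ)|` and its positivity; the concrete `κ` of the engine's
polynomial staple weights (sequel); the masked layer on the whole lattice (it is
`Theory2.coupleFun` of these one-link maps, cf. `KernelCouplingMask.lean`); any number.
-/

noncomputable section

namespace Summit.Ventures.LatticeQCDFlow.Exactness

open Literature.MathematicalPhysics.QuantumFieldTheory
open Literature.MathematicalPhysics.QuantumFieldTheory.Luscher2010
open scoped Matrix

variable {n : ℕ}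

/-! ## Values: the layer and the fixed-point map stay in `SU(n)` -/

/-- **The residual update of a special-unitary link is special unitary**: `e^{Q(U)} U ∈ SU(n)`
when `Q(U) ∈ 𝔰𝔲(n)`. -/
theorem residual_value_mem {Q : Matrix (Fin n) (Fin n) ℂ → Matrix (Fin n) (Fin n) ℂ}
    (hQ : ∀ U ∈ Matrix.specialUnitaryGroup (Fin n) ℂ, (Q U)ᴴ = -Q U ∧ (Q U).trace = 0)
    {U : Matrix (Fin n) (Fin n) ℂ} (hU : U ∈ Matrix.specialUnitaryGroup (Fin n) ℂ) :
    NormedSpace.exp (Q U) * U ∈ Matrix.specialUnitaryGroup (Fin n) ℂ :=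
  mul_mem (exp_mem_specialUnitaryGroup (hQ U hU).1 (hQ U hU).2) hU

/-- `e^{−X} U' ∈ SU(n)` for `X` skew-Hermitian traceless and `U' ∈ SU(n)` (the values of the
fixed-point map and of the inverse iteration). -/
theorem expNeg_mul_mem {X U' : Matrix (Fin n) (Fin n) ℂ} (hX : Xᴴ = -X) (hX0 : X.trace = 0)
    (hU' : U' ∈ Matrix.specialUnitaryGroup (Fin n) ℂ) :
    NormedSpace.exp (-X) * U' ∈ Matrix.specialUnitaryGroup (Fin n) ℂ :=
  mul_mem (exp_mem_specialUnitaryGroup (by rw [Matrix.conjTranspose_neg, hX, neg_neg])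
    (by rw [Matrix.trace_neg, hX0, neg_zero])) hU'

/-- `e^{−Q(U)} (e^{Q(U)} U) = U`: the fixed-point map at `U' = e^{Q U} U` fixes `U`. -/
theorem expNeg_mul_residual (Q : Matrix (Fin n) (Fin n) ℂ → Matrix (Fin n) (Fin n) ℂ)
    (U : Matrix (Fin n) (Fin n) ℂ) :
    NormedSpace.exp (-Q U) * (NormedSpace.exp (Q U) * U) = U := by
  rw [← Matrix.mul_assoc, exp_neg_mul_exp, Matrix.one_mul]

/-! ## The fixed-point map is a `κ`-contraction of `SU(n)` -/

/-- **`exp` composed with negation is `1`-Lipschitz on `𝔰𝔲(n)` after right translation**: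
`‖e^{−X} U' − e^{−Y} U'‖_F ≤ ‖X − Y‖_F` for skew-Hermitian `X, Y` and unitary `U'`. -/
theorem frobNorm_expNeg_mul_sub_le {X Y U' : Matrix (Fin n) (Fin n) ℂ} (hX : Xᴴ = -X) (hY : Yᴴ = -Y)
    (hU' : U' ∈ Matrix.unitaryGroup (Fin n) ℂ) :
    frobNorm (NormedSpace.exp (-X) * U' - NormedSpace.exp (-Y) * U') ≤ frobNorm (X - Y) := by
  rw [← Matrix.sub_mul, frobNorm_mul_unitary _ hU']
  calc frobNorm (NormedSpace.exp (-X) - NormedSpace.exp (-Y)) ≤ frobNorm (-X - -Y) :=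
        frobNorm_exp_sub_exp_le (by rw [Matrix.conjTranspose_neg, hX, neg_neg])
          (by rw [Matrix.conjTranspose_neg, hY, neg_neg])
    _ = frobNorm (X - Y) := by rw [neg_sub_neg, frobNorm_sub_comm]

/-- **The engine's fixed-point map `g(U) = e^{−Q(U)} U'` is a `κ`-contraction of `SU(n)`** in the
Frobenius norm, for every target `U' ∈ U(n)`, as soon as `Q` is `κ`-Lipschitz on `SU(n)` with
skew-Hermitian values (`κ ≥ 0`). -/
theorem frobNorm_fixedPointMap_sub_le {Q : Matrix (Fin n) (Fin n) ℂ → Matrix (Fin n) (Fin n) ℂ}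
    {κ : ℝ} (hQ : ∀ U ∈ Matrix.specialUnitaryGroup (Fin n) ℂ, (Q U)ᴴ = -Q U ∧ (Q U).trace = 0)
    (hlip : ∀ U ∈ Matrix.specialUnitaryGroup (Fin n) ℂ, ∀ V ∈ Matrix.specialUnitaryGroup (Fin n) ℂ,
      frobNorm (Q U - Q V) ≤ κ * frobNorm (U - V))
    {U V U' : Matrix (Fin n) (Fin n) ℂ} (hU : U ∈ Matrix.specialUnitaryGroup (Fin n) ℂ)
    (hV : V ∈ Matrix.specialUnitaryGroup (Fin n) ℂ) (hU' : U' ∈ Matrix.unitaryGroup (Fin n) ℂ) :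
    frobNorm (NormedSpace.exp (-Q U) * U' - NormedSpace.exp (-Q V) * U') ≤ κ * frobNorm (U - V) :=
  (frobNorm_expNeg_mul_sub_le (hQ U hU).1 (hQ V hV).1 hU').trans (hlip U hU V hV)

/-! ## Lüscher's transport to `𝔰𝔲(n)`: `X ↦ Q(e^{−X} U')` and its Banach fixed point -/

/-- **(D.6)–(D.7) with a general exponent**: `X ↦ Q(e^{−X} U')` is `κ`-Lipschitz on `𝔰𝔲(n)` for
`U' ∈ SU(n)`. -/
theorem frobNorm_luscherMap_sub_le {Q : Matrix (Fin n) (Fin n) ℂ → Matrix (Fin n) (Fin n) ℂ}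
    {κ : ℝ} (hκ0 : 0 ≤ κ)
    (hlip : ∀ U ∈ Matrix.specialUnitaryGroup (Fin n) ℂ, ∀ V ∈ Matrix.specialUnitaryGroup (Fin n) ℂ,
      frobNorm (Q U - Q V) ≤ κ * frobNorm (U - V))
    {U' : Matrix (Fin n) (Fin n) ℂ} (hU' : U' ∈ Matrix.specialUnitaryGroup (Fin n) ℂ)
    {X Y : Matrix (Fin n) (Fin n) ℂ} (hX : X ∈ suAlgebra n) (hY : Y ∈ suAlgebra n) :
    frobNorm (Q (NormedSpace.exp (-X) * U') - Q (NormedSpace.exp (-Y) * U')) ≤ κ * frobNorm (X - Y) := by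
  have hX' := (mem_suAlgebra_iff X).1 hX
  have hY' := (mem_suAlgebra_iff Y).1 hY
  calc frobNorm (Q (NormedSpace.exp (-X) * U') - Q (NormedSpace.exp (-Y) * U'))
        ≤ κ * frobNorm (NormedSpace.exp (-X) * U' - NormedSpace.exp (-Y) * U') :=
          hlip _ (expNeg_mul_mem hX'.1 hX'.2 hU') _ (expNeg_mul_mem hY'.1 hY'.2 hU')
    _ ≤ κ * frobNorm (X - Y) :=
          mul_le_mul_of_nonneg_left (frobNorm_expNeg_mul_sub_le hX'.1 hY'.1
            (Matrix.mem_specialUnitaryGroup_iff.mp hU').1) hκ0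

/-- **Banach fixed point on the complete space `(𝔰𝔲(n), ‖·‖_F)`**: for `0 ≤ κ < 1` and
`U' ∈ SU(n)` there is exactly one `X⋆ ∈ 𝔰𝔲(n)` with `Q(e^{−X⋆} U') = X⋆`. -/
theorem existsUnique_fixedPoint_luscherMap {Q : Matrix (Fin n) (Fin n) ℂ → Matrix (Fin n) (Fin n) ℂ}
    {κ : ℝ} (hκ0 : 0 ≤ κ) (hκ : κ < 1)
    (hQ : ∀ U ∈ Matrix.specialUnitaryGroup (Fin n) ℂ, (Q U)ᴴ = -Q U ∧ (Q U).trace = 0)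
    (hlip : ∀ U ∈ Matrix.specialUnitaryGroup (Fin n) ℂ, ∀ V ∈ Matrix.specialUnitaryGroup (Fin n) ℂ,
      frobNorm (Q U - Q V) ≤ κ * frobNorm (U - V))
    {U' : Matrix (Fin n) (Fin n) ℂ} (hU' : U' ∈ Matrix.specialUnitaryGroup (Fin n) ℂ) :
    ∃ Xs ∈ suAlgebra n, Q (NormedSpace.exp (-Xs) * U') = Xs ∧
      ∀ X ∈ suAlgebra n, Q (NormedSpace.exp (-X) * U') = X → X = Xs := by
  classical
  have hmem : ∀ X ∈ suAlgebra n, Q (NormedSpace.exp (-X) * U') ∈ suAlgebra n := fun X hX => by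
    have hX' := (mem_suAlgebra_iff X).1 hX
    exact (mem_suAlgebra_iff _).2 (hQ _ (expNeg_mul_mem hX'.1 hX'.2 hU'))
  open scoped Matrix.Norms.Frobenius in
  haveI : CompleteSpace ↥(suAlgebra n) :=
    (Submodule.complete_of_finiteDimensional (suAlgebra n)).completeSpace_coe
  let g : ↥(suAlgebra n) → ↥(suAlgebra n) := fun X =>
    ⟨Q (NormedSpace.exp (-(X : Matrix (Fin n) (Fin n) ℂ)) * U'), hmem X X.2⟩
  let K : NNReal := ⟨κ, hκ0⟩
  open scoped Matrix.Norms.Frobenius in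
  have hdist : ∀ X Y : ↥(suAlgebra n),
      dist X Y = frobNorm ((X : Matrix (Fin n) (Fin n) ℂ) - (Y : Matrix (Fin n) (Fin n) ℂ)) :=
    fun X Y => by rw [Subtype.dist_eq, dist_eq_norm, frobNorm_eq_norm]
  open scoped Matrix.Norms.Frobenius in
  have hlipg : LipschitzWith K g := by
    refine LipschitzWith.of_dist_le_mul fun X Y => ?_
    rw [hdist, hdist]
    exact frobNorm_luscherMap_sub_le hκ0 hlip hU' X.2 Y.2
  have hK1 : K < 1 := by
    rw [← NNReal.coe_lt_coe]
    exact hκ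
  open scoped Matrix.Norms.Frobenius in
  have hc : ContractingWith K g := ⟨hK1, hlipg⟩
  open scoped Matrix.Norms.Frobenius in
  refine ⟨(ContractingWith.fixedPoint g hc : ↥(suAlgebra n)), (ContractingWith.fixedPoint g hc).2,
    ?_, ?_⟩
  · exact congrArg Subtype.val (ContractingWith.fixedPoint_isFixedPt (f := g) hc)
  · intro X hXmem hfix
    have h := ContractingWith.fixedPoint_unique hc (x := ⟨X, hXmem⟩) (Subtype.ext hfix)
    exact congrArg Subtype.val h

/-! ## The guard's claim: unique pre-image, bijection -/

/-- **Every `U' ∈ SU(n)` has EXACTLY ONE pre-image under the residual layer** `U ↦ e^{Q(U)} U`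
when `Q : SU(n) → 𝔰𝔲(n)` is `κ`-Lipschitz in the Frobenius norm with `0 ≤ κ < 1` — the
statement the engine's `kappa < kappa_limit = 1` guard certifies, for every `n`.  Existence: with
`X⋆` the fixed point of `X ↦ Q(e^{−X} U')`, `U = e^{−X⋆} U'` has `Q(U) = X⋆` and
`e^{Q U} U = e^{X⋆} e^{−X⋆} U' = U'`.  Uniqueness: if `e^{Q V} V = U'` then `Q V` is a fixed
point too. -/
theorem existsUnique_residual_preimage {Q : Matrix (Fin n) (Fin n) ℂ → Matrix (Fin n) (Fin n) ℂ}
    {κ : ℝ} (hκ0 : 0 ≤ κ) (hκ : κ < 1)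
    (hQ : ∀ U ∈ Matrix.specialUnitaryGroup (Fin n) ℂ, (Q U)ᴴ = -Q U ∧ (Q U).trace = 0)
    (hlip : ∀ U ∈ Matrix.specialUnitaryGroup (Fin n) ℂ, ∀ V ∈ Matrix.specialUnitaryGroup (Fin n) ℂ,
      frobNorm (Q U - Q V) ≤ κ * frobNorm (U - V))
    {U' : Matrix (Fin n) (Fin n) ℂ} (hU' : U' ∈ Matrix.specialUnitaryGroup (Fin n) ℂ) :
    ∃ U ∈ Matrix.specialUnitaryGroup (Fin n) ℂ, NormedSpace.exp (Q U) * U = U' ∧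
      ∀ V ∈ Matrix.specialUnitaryGroup (Fin n) ℂ, NormedSpace.exp (Q V) * V = U' → V = U := by
  obtain ⟨Xs, hXs, hfix, huniq⟩ := existsUnique_fixedPoint_luscherMap hκ0 hκ hQ hlip hU'
  have hXs' := (mem_suAlgebra_iff Xs).1 hXs
  refine ⟨NormedSpace.exp (-Xs) * U', expNeg_mul_mem hXs'.1 hXs'.2 hU', ?_, ?_⟩
  · rw [hfix, ← Matrix.mul_assoc, exp_mul_exp_neg, Matrix.one_mul]
  · intro V hV hVU'
    have hQV : Q V ∈ suAlgebra n := (mem_suAlgebra_iff _).2 (hQ V hV)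
    have hV' : NormedSpace.exp (-Q V) * U' = V := by rw [← hVU', expNeg_mul_residual]
    have hfixV : Q (NormedSpace.exp (-Q V) * U') = Q V := by rw [hV']
    have hQVs : Q V = Xs := huniq (Q V) hQV hfixV
    rw [← hV', hQVs]

/-- **The one-link residual layer is a bijection of `SU(n)`** (as a self-map of the subtype). -/
theorem residualLayer_bijective {Q : Matrix (Fin n) (Fin n) ℂ → Matrix (Fin n) (Fin n) ℂ}
    {κ : ℝ} (hκ0 : 0 ≤ κ) (hκ : κ < 1)
    (hQ : ∀ U ∈ Matrix.specialUnitaryGroup (Fin n) ℂ, (Q U)ᴴ = -Q U ∧ (Q U).trace = 0)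
    (hlip : ∀ U ∈ Matrix.specialUnitaryGroup (Fin n) ℂ, ∀ V ∈ Matrix.specialUnitaryGroup (Fin n) ℂ,
      frobNorm (Q U - Q V) ≤ κ * frobNorm (U - V)) :
    Function.Bijective fun U : Matrix.specialUnitaryGroup (Fin n) ℂ =>
      (⟨NormedSpace.exp (Q U) * U, residual_value_mem hQ U.2⟩ : Matrix.specialUnitaryGroup (Fin n) ℂ) := by
  refine ⟨fun U V hUV => ?_, fun U' => ?_⟩
  · obtain ⟨W, -, -, huniq⟩ := existsUnique_residual_preimage hκ0 hκ hQ hlip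
      (residual_value_mem hQ U.2)
    have hV : NormedSpace.exp (Q (V : Matrix (Fin n) (Fin n) ℂ)) * V =
        NormedSpace.exp (Q (U : Matrix (Fin n) (Fin n) ℂ)) * U := (congrArg Subtype.val hUV).symm
    exact Subtype.ext ((huniq U U.2 rfl).trans (huniq V V.2 hV).symm)
  · obtain ⟨U, hU, hUU', -⟩ := existsUnique_residual_preimage hκ0 hκ hQ hlip U'.2
    exact ⟨⟨U, hU⟩, Subtype.ext hUU'⟩

/-! ## The inverse pass: geometric convergence of `U_{k+1} = e^{−Q(U_k)} U'` from any start -/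

/-- **The engine's inverse iteration converges geometrically at rate `κ`.**  Let `U⋆ ∈ SU(n)` be
the pre-image of `U' ∈ SU(n)` (`e^{Q U⋆} U⋆ = U'`).  From ANY start `U₀ ∈ SU(n)` the iterates
`U_k = g^{[k]} U₀` of `g(U) = e^{−Q(U)} U'` stay in `SU(n)` and satisfy
`‖U_k − U⋆‖_F ≤ κ^k · ‖U₀ − U⋆‖_F` — `U⋆ = g(U⋆)` and `g` is a `κ`-contraction. -/
theorem frobNorm_inverseIteration_le {Q : Matrix (Fin n) (Fin n) ℂ → Matrix (Fin n) (Fin n) ℂ}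
    {κ : ℝ} (hκ0 : 0 ≤ κ)
    (hQ : ∀ U ∈ Matrix.specialUnitaryGroup (Fin n) ℂ, (Q U)ᴴ = -Q U ∧ (Q U).trace = 0)
    (hlip : ∀ U ∈ Matrix.specialUnitaryGroup (Fin n) ℂ, ∀ V ∈ Matrix.specialUnitaryGroup (Fin n) ℂ,
      frobNorm (Q U - Q V) ≤ κ * frobNorm (U - V))
    {U' Us U₀ : Matrix (Fin n) (Fin n) ℂ} (hU' : U' ∈ Matrix.specialUnitaryGroup (Fin n) ℂ)
    (hUs : Us ∈ Matrix.specialUnitaryGroup (Fin n) ℂ) (hfix : NormedSpace.exp (Q Us) * Us = U')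
    (hU₀ : U₀ ∈ Matrix.specialUnitaryGroup (Fin n) ℂ) (k : ℕ) :
    (fun U => NormedSpace.exp (-Q U) * U')^[k] U₀ ∈ Matrix.specialUnitaryGroup (Fin n) ℂ ∧
      frobNorm ((fun U => NormedSpace.exp (-Q U) * U')^[k] U₀ - Us) ≤ κ ^ k * frobNorm (U₀ - Us) := by
  have hgUs : NormedSpace.exp (-Q Us) * U' = Us := by rw [← hfix, expNeg_mul_residual]
  induction k with
  | zero =>
    simp only [Function.iterate_zero, id_eq, pow_zero, one_mul]
    exact ⟨hU₀, le_rfl⟩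
  | succ k ih =>
    obtain ⟨hmem, hle⟩ := ih
    rw [Function.iterate_succ_apply']
    refine ⟨expNeg_mul_mem (hQ _ hmem).1 (hQ _ hmem).2 hU', ?_⟩
    calc frobNorm (NormedSpace.exp (-Q ((fun U => NormedSpace.exp (-Q U) * U')^[k] U₀)) * U' - Us)
          = frobNorm (NormedSpace.exp (-Q ((fun U => NormedSpace.exp (-Q U) * U')^[k] U₀)) * U' -
              NormedSpace.exp (-Q Us) * U') := by rw [hgUs]
      _ ≤ κ * frobNorm ((fun U => NormedSpace.exp (-Q U) * U')^[k] U₀ - Us) :=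
          frobNorm_fixedPointMap_sub_le hQ hlip hmem hUs (Matrix.mem_specialUnitaryGroup_iff.mp hU').1
      _ ≤ κ * (κ ^ k * frobNorm (U₀ - Us)) := mul_le_mul_of_nonneg_left hle hκ0
      _ = κ ^ (k + 1) * frobNorm (U₀ - Us) := by rw [pow_succ]; ring

/-! ## Two-sided Lipschitz bounds: the layer is bi-Lipschitz on `SU(n)` -/

/-- **The inverse of the layer is `(1 − κ)⁻¹`-Lipschitz**: for `U, V ∈ SU(n)`,
`(1 − κ) ‖U − V‖_F ≤ ‖e^{Q U} U − e^{Q V} V‖_F` — writing `U = e^{−Q U} U'`, `V = e^{−Q V} V'`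
with `U' = e^{Q U} U`, `V' = e^{Q V} V`:
`‖U − V‖_F ≤ ‖e^{−Q U}(U' − V')‖_F + ‖(e^{−Q U} − e^{−Q V}) V'‖_F ≤ ‖U' − V'‖_F + κ ‖U − V‖_F`. -/
theorem frobNorm_sub_le_of_residual {Q : Matrix (Fin n) (Fin n) ℂ → Matrix (Fin n) (Fin n) ℂ}
    {κ : ℝ} (hQ : ∀ U ∈ Matrix.specialUnitaryGroup (Fin n) ℂ, (Q U)ᴴ = -Q U ∧ (Q U).trace = 0)
    (hlip : ∀ U ∈ Matrix.specialUnitaryGroup (Fin n) ℂ, ∀ V ∈ Matrix.specialUnitaryGroup (Fin n) ℂ,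
      frobNorm (Q U - Q V) ≤ κ * frobNorm (U - V))
    {U V : Matrix (Fin n) (Fin n) ℂ} (hU : U ∈ Matrix.specialUnitaryGroup (Fin n) ℂ)
    (hV : V ∈ Matrix.specialUnitaryGroup (Fin n) ℂ) :
    (1 - κ) * frobNorm (U - V) ≤
      frobNorm (NormedSpace.exp (Q U) * U - NormedSpace.exp (Q V) * V) := by
  set U' := NormedSpace.exp (Q U) * U with hU'
  set V' := NormedSpace.exp (Q V) * V with hV'
  have hV'u : V' ∈ Matrix.unitaryGroup (Fin n) ℂ :=
    (Matrix.mem_specialUnitaryGroup_iff.mp (residual_value_mem hQ hV)).1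
  have hexpU : NormedSpace.exp (-Q U) ∈ Matrix.unitaryGroup (Fin n) ℂ :=
    (Matrix.mem_specialUnitaryGroup_iff.mp (exp_mem_specialUnitaryGroup
      (by rw [Matrix.conjTranspose_neg, (hQ U hU).1, neg_neg])
      (by rw [Matrix.trace_neg, (hQ U hU).2, neg_zero]))).1
  have hdecomp : U - V = NormedSpace.exp (-Q U) * (U' - V') +
      (NormedSpace.exp (-Q U) * V' - NormedSpace.exp (-Q V) * V') := by
    rw [Matrix.mul_sub, hU', hV', expNeg_mul_residual, expNeg_mul_residual]
    abel
  have h1 : frobNorm (U - V) ≤ frobNorm (U' - V') + κ * frobNorm (U - V) := by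
    calc frobNorm (U - V) = frobNorm (NormedSpace.exp (-Q U) * (U' - V') +
          (NormedSpace.exp (-Q U) * V' - NormedSpace.exp (-Q V) * V')) := by rw [← hdecomp]
      _ ≤ frobNorm (NormedSpace.exp (-Q U) * (U' - V')) +
            frobNorm (NormedSpace.exp (-Q U) * V' - NormedSpace.exp (-Q V) * V') := frobNorm_add_le _ _
      _ ≤ frobNorm (U' - V') + κ * frobNorm (U - V) := by
          rw [frobNorm_unitary_mul hexpU]
          exact add_le_add le_rfl (frobNorm_fixedPointMap_sub_le hQ hlip hU hV hV'u)
  linarith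

/-- **The layer is `(1 + κ)`-Lipschitz**: `‖e^{Q U} U − e^{Q V} V‖_F ≤ (1 + κ) ‖U − V‖_F` for
`U, V ∈ SU(n)` (`e^{Q U}(U − V) + (e^{Q U} − e^{Q V}) V`). -/
theorem frobNorm_residual_sub_le {Q : Matrix (Fin n) (Fin n) ℂ → Matrix (Fin n) (Fin n) ℂ}
    {κ : ℝ} (hQ : ∀ U ∈ Matrix.specialUnitaryGroup (Fin n) ℂ, (Q U)ᴴ = -Q U ∧ (Q U).trace = 0)
    (hlip : ∀ U ∈ Matrix.specialUnitaryGroup (Fin n) ℂ, ∀ V ∈ Matrix.specialUnitaryGroup (Fin n) ℂ,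
      frobNorm (Q U - Q V) ≤ κ * frobNorm (U - V))
    {U V : Matrix (Fin n) (Fin n) ℂ} (hU : U ∈ Matrix.specialUnitaryGroup (Fin n) ℂ)
    (hV : V ∈ Matrix.specialUnitaryGroup (Fin n) ℂ) :
    frobNorm (NormedSpace.exp (Q U) * U - NormedSpace.exp (Q V) * V) ≤ (1 + κ) * frobNorm (U - V) := by
  have hVu : V ∈ Matrix.unitaryGroup (Fin n) ℂ := (Matrix.mem_specialUnitaryGroup_iff.mp hV).1
  have hexpU : NormedSpace.exp (Q U) ∈ Matrix.unitaryGroup (Fin n) ℂ :=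
    (Matrix.mem_specialUnitaryGroup_iff.mp (exp_mem_specialUnitaryGroup (hQ U hU).1 (hQ U hU).2)).1
  have hdecomp : NormedSpace.exp (Q U) * U - NormedSpace.exp (Q V) * V =
      NormedSpace.exp (Q U) * (U - V) + (NormedSpace.exp (Q U) - NormedSpace.exp (Q V)) * V := by
    rw [Matrix.mul_sub, Matrix.sub_mul]
    abel
  rw [hdecomp]
  calc frobNorm (NormedSpace.exp (Q U) * (U - V) + (NormedSpace.exp (Q U) - NormedSpace.exp (Q V)) * V)
        ≤ frobNorm (NormedSpace.exp (Q U) * (U - V)) +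
          frobNorm ((NormedSpace.exp (Q U) - NormedSpace.exp (Q V)) * V) := frobNorm_add_le _ _
    _ = frobNorm (U - V) + frobNorm (NormedSpace.exp (Q U) - NormedSpace.exp (Q V)) := by
          rw [frobNorm_unitary_mul hexpU, frobNorm_mul_unitary _ hVu]
    _ ≤ frobNorm (U - V) + κ * frobNorm (U - V) :=
          add_le_add le_rfl ((frobNorm_exp_sub_exp_le (hQ U hU).1 (hQ V hV).1).trans (hlip U hU V hV))
    _ = (1 + κ) * frobNorm (U - V) := by ring

/-- **The inverse layer is Lipschitz, pre-image form**: if `e^{Q U} U = U'` and `e^{Q V} V = V'`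
with `U, V ∈ SU(n)` then `‖U − V‖_F ≤ (1 − κ)⁻¹ ‖U' − V'‖_F` — nearby outputs have nearby
pre-images, uniformly on `SU(n)` (continuity of the engine's `inverse`). -/
theorem frobNorm_preimage_sub_le {Q : Matrix (Fin n) (Fin n) ℂ → Matrix (Fin n) (Fin n) ℂ}
    {κ : ℝ} (hκ : κ < 1)
    (hQ : ∀ U ∈ Matrix.specialUnitaryGroup (Fin n) ℂ, (Q U)ᴴ = -Q U ∧ (Q U).trace = 0)
    (hlip : ∀ U ∈ Matrix.specialUnitaryGroup (Fin n) ℂ, ∀ V ∈ Matrix.specialUnitaryGroup (Fin n) ℂ,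
      frobNorm (Q U - Q V) ≤ κ * frobNorm (U - V))
    {U V U' V' : Matrix (Fin n) (Fin n) ℂ} (hU : U ∈ Matrix.specialUnitaryGroup (Fin n) ℂ)
    (hV : V ∈ Matrix.specialUnitaryGroup (Fin n) ℂ) (hUU' : NormedSpace.exp (Q U) * U = U')
    (hVV' : NormedSpace.exp (Q V) * V = V') :
    frobNorm (U - V) ≤ (1 - κ)⁻¹ * frobNorm (U' - V') := by
  have h := frobNorm_sub_le_of_residual hQ hlip hU hV
  rw [hUU', hVV'] at h
  have h1κ : 0 < 1 - κ := by linarith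
  rw [le_inv_mul_iff₀ h1κ]
  exact h

end Summit.Ventures.LatticeQCDFlow.Exactness
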